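import Literature.Probability.RandomPlanarGeometry.PolylineUniform
import Literature.Probability.RandomPlanarGeometry.CurveMonotoneReparam

/-!
# Port transfer, part B₀: two elementary facts on polylines modulo reparametrisation

Helper file of the line `Sketch` for the crux `HexTransfer` (stmt-CriticalPhenomena-14221), stub
`stub_portTransfer` (the O(δ) coupling between the compass self-avoiding walk and
Glazman–Manolescu's Yang–Baxter walk at `Θ ≡ π/2`). Two facts about the tree's dyadic polyline
`Literature.Probability.LatticeModels.polyline` as a point of `CurveClass E`:

* `mk_polyline_stay` — **repeating vertices does not change the curve class.** For a start point
  `q` and a list `t` of *optional* points, `stay q t` is the list of the same length which copies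
  the points of `t` and repeats the last point seen at every `none`; the polyline through
  `q :: stay q t` and the polyline through `q :: t.reduceOption` are reparametrisations of ONE
  uniformly parametrised polyline (`Polyline.uniform`) by two continuous monotone clocks
  (`Polyline.clock`, and `stayClock t ∘ clock`), hence define the same class
  (`Curve.reparamDist_eq_zero_of_monotone'`).
* `dist_mk_polyline_le` — **two polylines through lists of the same length whose vertices are
  pairwise `ε`-close are `ε`-close** (same dyadic parametrisation, convexity of each pair of
  segments).

Elementary real-variable bookkeeping (Camia–Newman 2007, §2; Aizenman–Burchard 1999, §2.1);
tagged [folklore].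
-/

noncomputable section

namespace Summit.CriticalPhenomena.SAWScalingLimit.Cruxes.HexTransfer.Sketch.PortTransfer

open Set
open scoped unitInterval Topology
open Literature.Probability.LatticeModels (polyline polylineFrom polylineFrom_nil polylineFrom_cons)
open Literature.Probability.RandomPlanarGeometry
open Literature.Probability.RandomPlanarGeometry.Polyline

section Combinatorial

variable {E : Type*}

/-! ### Repeating vertices: the `stay` list and its clock -/

/-- `stay q t`: walk along the optional points of `t`, copying each `some r` and repeating the
last point seen (initially `q`) at each `none`; a list of the same length as `t`. [folklore] -/
def stay : E → List (Option E) → List E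
  | _, [] => []
  | q, none :: t => q :: stay q t
  | _, some r :: t => r :: stay r t

/-- `stay` at a `none`: repeat the current point. [folklore] -/
@[simp] theorem stay_cons_none (q : E) (t : List (Option E)) :
    stay q (none :: t) = q :: stay q t := rfl

/-- `stay` at a `some r`: move to `r`. [folklore] -/
@[simp] theorem stay_cons_some (q r : E) (t : List (Option E)) :
    stay q (some r :: t) = r :: stay r t := rfl

/-- `stay` preserves the length. [folklore] -/
@[simp] theorem length_stay : ∀ (q : E) (t : List (Option E)), (stay q t).length = t.length
  | _, [] => rfl
  | q, none :: t => by simp [length_stay q t]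
  | _, some r :: t => by simp [length_stay r t]

/-- `stay` commutes with maps. [folklore] -/
theorem map_stay {F : Type*} (g : E → F) :
    ∀ (q : E) (t : List (Option E)), (stay q t).map g = stay (g q) (t.map (Option.map g))
  | _, [] => rfl
  | q, none :: t => by simp [map_stay g q t]
  | _, some r :: t => by simp [map_stay g r t]

/-- The clock of `stay q t` relative to `t.reduceOption` in uniform time: during the `k`-th unit
of time it advances by one unit if the `k`-th entry of `t` is a point and rests if it is `none`.
[folklore] -/
def stayClock : List (Option E) → ℝ → ℝ
  | [], _ => 0
  | none :: t, s => if s ≤ 1 then 0 else stayClock t (s - 1)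
  | some _ :: t, s => if s ≤ 1 then max s 0 else 1 + stayClock t (s - 1)

/-- The clock rests at `0` up to time `0`. [folklore] -/
theorem stayClock_of_nonpos : ∀ (t : List (Option E)) {s : ℝ}, s ≤ 0 → stayClock t s = 0
  | [], _, _ => rfl
  | none :: t, s, hs => by simp [stayClock, show s ≤ 1 by linarith]
  | some r :: t, s, hs => by simp [stayClock, show s ≤ 1 by linarith, hs]

/-- The clock starts at `0`. [folklore] -/
@[simp] theorem stayClock_zero (t : List (Option E)) : stayClock t 0 = 0 :=
  stayClock_of_nonpos t le_rfl

/-- The clock is nonnegative. [folklore] -/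
theorem stayClock_nonneg : ∀ (t : List (Option E)) (s : ℝ), 0 ≤ stayClock t s
  | [], _ => le_rfl
  | none :: t, s => by
      simp only [stayClock]
      split_ifs
      · exact le_rfl
      · exact stayClock_nonneg t _
  | some r :: t, s => by
      simp only [stayClock]
      split_ifs
      · exact le_max_right _ _
      · exact add_nonneg zero_le_one (stayClock_nonneg t _)

/-- The clock is monotone. [folklore] -/
theorem monotone_stayClock : ∀ t : List (Option E), Monotone (stayClock t)
  | [] => fun _ _ _ => le_rfl
  | none :: t => fun s s' hss' => by
      simp only [stayClock]
      split_ifs with hs hs' hs'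
      · exact le_rfl
      · exact stayClock_nonneg t _
      · exact absurd (hss'.trans hs') hs
      · exact monotone_stayClock t (by linarith)
  | some r :: t => fun s s' hss' => by
      simp only [stayClock]
      split_ifs with hs hs' hs'
      · exact max_le_max hss' le_rfl
      · exact (max_le hs zero_le_one).trans (by linarith [stayClock_nonneg t (s' - 1)])
      · exact absurd (hss'.trans hs') hs
      · linarith [monotone_stayClock t (show s - 1 ≤ s' - 1 by linarith)]

/-- The clock is continuous. [folklore] -/
theorem continuous_stayClock : ∀ t : List (Option E), Continuous (stayClock t)
  | [] => continuous_const
  | none :: t => by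
      change Continuous fun s : ℝ => if s ≤ 1 then (0 : ℝ) else stayClock t (s - 1)
      refine Continuous.if_le continuous_const
        ((continuous_stayClock t).comp (continuous_id.sub continuous_const)) continuous_id
        continuous_const ?_
      rintro s rfl
      simp
  | some r :: t => by
      change Continuous fun s : ℝ => if s ≤ 1 then max s 0 else 1 + stayClock t (s - 1)
      refine Continuous.if_le (by fun_prop)
        (continuous_const.add ((continuous_stayClock t).comp (continuous_id.sub continuous_const)))
        continuous_id continuous_const ?_
      rintro s rfl
      simp

/-- At the final time `t.length` the clock shows the number of points of `t`. [folklore] -/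
theorem stayClock_length : ∀ t : List (Option E),
    stayClock t (t.length : ℝ) = (t.reduceOption.length : ℝ)
  | [] => by simp [stayClock]
  | none :: t => by
      rw [List.reduceOption_cons_of_none, List.length_cons]
      simp only [stayClock, Nat.cast_add, Nat.cast_one, add_sub_cancel_right]
      split_ifs with h
      · have h0 : t.length = 0 := by
          by_contra hne
          have : (1 : ℝ) ≤ t.length := by exact_mod_cast Nat.one_le_iff_ne_zero.2 hne
          linarith
        rw [List.length_eq_zero_iff.1 h0]
        simp
      · exact stayClock_length t
  | some r :: t => by
      rw [List.reduceOption_cons_of_some, List.length_cons, List.length_cons]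
      simp only [stayClock, Nat.cast_add, Nat.cast_one, add_sub_cancel_right]
      split_ifs with h
      · have h0 : t.length = 0 := by
          by_contra hne
          have : (1 : ℝ) ≤ t.length := by exact_mod_cast Nat.one_le_iff_ne_zero.2 hne
          linarith
        rw [List.length_eq_zero_iff.1 h0]
        simp
      · rw [stayClock_length t]
        ring

end Combinatorial

section Normed

variable {E : Type*} [NormedAddCommGroup E] [NormedSpace ℝ E]

/-- **The core identity**: in uniform time, the polyline through `q :: stay q t` is the polyline
through `q :: t.reduceOption` run with the clock `stayClock t`. [folklore] -/
theorem uniform_stay (t : List (Option E)) :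
    ∀ (q : E) (s : ℝ), uniform q (stay q t) s = uniform q t.reduceOption (stayClock t s) := by
  induction t with
  | nil => intro q s; simp [stay]
  | cons o t ih =>
    intro q s
    cases o with
    | none =>
      rw [stay_cons_none, uniform_cons, List.reduceOption_cons_of_none]
      simp only [stayClock]
      split_ifs with h
      · rw [Path.segment_same, Path.refl_extend, uniform_zero]
        rfl
      · exact ih q (s - 1)
    | some r =>
      rw [stay_cons_some, uniform_cons, List.reduceOption_cons_of_some]
      simp only [stayClock]
      split_ifs with h
      · rw [uniform_cons, if_pos (max_le h zero_le_one)]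
        rcases le_total s 0 with hs | hs
        · rw [max_eq_right hs, Path.extend_of_le_zero _ hs, Path.extend_zero]
        · rw [max_eq_left hs]
      · rw [ih r (s - 1), uniform_cons]
        rcases (stayClock_nonneg t (s - 1)).eq_or_lt with hc | hc
        · rw [← hc, if_pos (by norm_num), add_zero, Path.extend_one, uniform_zero]
        · rw [if_neg (by linarith), add_sub_cancel_left]

/-- **Repeating vertices does not change the curve class**: the dyadic polylines through
`q :: stay q t` and through `q :: t.reduceOption` are at reparametrisation distance `0`, i.e.
equal in `CurveClass E` (both are monotone continuous reparametrisations of the uniform polyline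
through `q :: t.reduceOption`). [folklore] -/
theorem mk_polyline_stay (q : E) (t : List (Option E)) :
    CurveClass.mk ⟨polyline (q :: stay q t)⟩ =
      CurveClass.mk (E := E) ⟨polyline (q :: t.reduceOption)⟩ := by
  rw [CurveClass.mk_eq_mk]
  refine Curve.reparamDist_eq_zero_of_monotone' (m := (t.reduceOption.length : ℝ))
    (Nat.cast_nonneg _) (V := uniform q t.reduceOption) (continuous_uniform _ _).continuousOn
    (h₁ := fun τ => stayClock t (clock t.length τ)) (h₂ := clock t.reduceOption.length)
    ((continuous_stayClock t).comp (continuous_clock _)) (continuous_clock _)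
    ((monotone_stayClock t).comp (monotone_clock _)) (monotone_clock _) ?_ (clock_zero _) ?_
    (clock_one _) ?_ ?_
  · simp
  · rw [clock_one, stayClock_length]
  · intro τ
    change polyline (q :: stay q t) τ = _
    rw [polyline_apply_eq_uniform_clock, length_stay, uniform_stay]
  · intro τ
    exact polyline_apply_eq_uniform_clock q _ τ

/-! ### Two polylines with pairwise close vertices -/

/-- Convex combinations with the same coefficient of two `ε`-close pairs are `ε`-close.
[folklore] -/
theorem dist_lineMap_lineMap_le {a₁ a₂ b₁ b₂ : E} {ε c : ℝ} (hc0 : 0 ≤ c) (hc1 : c ≤ 1)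
    (ha : dist a₁ a₂ ≤ ε) (hb : dist b₁ b₂ ≤ ε) :
    dist (AffineMap.lineMap a₁ b₁ c) (AffineMap.lineMap a₂ b₂ c) ≤ ε := by
  rw [AffineMap.lineMap_apply_module, AffineMap.lineMap_apply_module, dist_eq_norm]
  have hc1' : 0 ≤ 1 - c := by linarith
  calc ‖(1 - c) • a₁ + c • b₁ - ((1 - c) • a₂ + c • b₂)‖
      = ‖(1 - c) • (a₁ - a₂) + c • (b₁ - b₂)‖ := by
        congr 1
        simp only [smul_sub]
        abel
    _ ≤ ‖(1 - c) • (a₁ - a₂)‖ + ‖c • (b₁ - b₂)‖ := norm_add_le _ _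
    _ = (1 - c) * dist a₁ a₂ + c * dist b₁ b₂ := by
        rw [norm_smul, norm_smul, Real.norm_of_nonneg hc1', Real.norm_of_nonneg hc0, dist_eq_norm,
          dist_eq_norm]
    _ ≤ (1 - c) * ε + c * ε :=
        add_le_add (mul_le_mul_of_nonneg_left ha hc1') (mul_le_mul_of_nonneg_left hb hc0)
    _ = ε := by ring

/-- Two `polylineFrom`s with the same number of vertices, pairwise `ε`-close, are pointwise
`ε`-close (same dyadic parametrisation). [folklore] -/
theorem dist_polylineFrom_apply_le {ε : ℝ} {l₁ l₂ : List E}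
    (h : List.Forall₂ (fun x y => dist x y ≤ ε) l₁ l₂) :
    ∀ {a₁ a₂ : E}, dist a₁ a₂ ≤ ε →
      ∀ t : I, dist ((polylineFrom a₁ l₁).2 t) ((polylineFrom a₂ l₂).2 t) ≤ ε := by
  induction h with
  | nil =>
    intro a₁ a₂ ha t
    exact ha
  | @cons b₁ b₂ l₁ l₂ hb _ ih =>
    intro a₁ a₂ ha t
    rw [polylineFrom_cons, polylineFrom_cons]
    dsimp only
    rw [Path.trans_apply, Path.trans_apply]
    split_ifs with ht
    · rw [Path.segment_apply, Path.segment_apply]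
      exact dist_lineMap_lineMap_le (by have := t.2.1; dsimp only; positivity)
        (by dsimp only; linarith) ha hb
    · exact ih hb _

/-- Two polylines with the same number of vertices, pairwise `ε`-close, are pointwise `ε`-close.
[folklore] -/
theorem dist_polyline_apply_le {ε : ℝ} (hε : 0 ≤ ε) {l₁ l₂ : List E}
    (h : List.Forall₂ (fun x y => dist x y ≤ ε) l₁ l₂) (t : I) :
    dist (polyline l₁ t) (polyline l₂ t) ≤ ε := by
  cases h with
  | nil => simpa using hε
  | cons ha hl => exact dist_polylineFrom_apply_le hl ha t

/-- **Two polylines with the same number of vertices, pairwise `ε`-close, are `ε`-close as curve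
classes.** [folklore] -/
theorem dist_mk_polyline_le {ε : ℝ} (hε : 0 ≤ ε) {l₁ l₂ : List E}
    (h : List.Forall₂ (fun x y => dist x y ≤ ε) l₁ l₂) :
    dist (CurveClass.mk ⟨polyline l₁⟩) (CurveClass.mk (E := E) ⟨polyline l₂⟩) ≤ ε := by
  rw [CurveClass.dist_mk_mk]
  refine (Curve.dist_le_dist_toContinuousMap _ _).trans ?_
  exact (ContinuousMap.dist_le hε).2 fun t => dist_polyline_apply_le hε h t

end Normed

end Summit.CriticalPhenomena.SAWScalingLimit.Cruxes.HexTransfer.Sketch.PortTransfer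

end
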